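import Summits.QuantumFields.YangMills.Theorems.UnitScaleTiltHalvingHMemberPackBaseOfStokesRowS
import Summits.QuantumFields.YangMills.Theorems.UnitScaleTiltHalvingHMemberPackStepOfStokesRowS
import Summits.QuantumFields.YangMills.Theorems.UnitScaleTiltHalvingHSupURho5OfMemberPacks
import HarnessLib

/-!
# Route `UnitScaleTilt`, crux K1 child «MinimiserStabilityRegPr» (stmt-QuantumFields-19200), registered stub `stub_halvingStep` (v10 `BirthV10`) —
# **LEAD-H g7 (K-final v10-preσ, BOARD v10-preσ): «H = the fat-loop STOKES ROW (b), at K − n = 1 and at 2 ≤ K − n» — NO [4]∕[B8] socket is displayed any more.**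
# ★★★ `hSupUρ5_of_stokesRowS (hSockets₁) (hSockets₂) : <hSupUρ5 VERBATIM>` := ✓`hSupUρ5_of_memberPacks` (ym-ust-20520-w5 g9) ∘ (✓`memberPack_base_of_stokesRowS`, ✓`memberPack_step_of_stokesRowS` (px20 g5)).  v10-pre = v9 with the last displayed socket row, the (1.42) collar residual `⟨H42topCrossT⟩`, DISCHARGED IN THE PACKS by the (M2′)
# assembly ✓p694481∕✓p697434 `h42topCrossT_of_stokes(_all)` (w8-19200 g9, px8 g5; generic ✓`H42cross_of_defect` over the ℤᵈ spine ✓p686655 of ym-ust-20520-w5 g9) fed by composer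
# v3.3's (a-row) (✓p695633∕✓p695647 ∘ dictionary ✓p691497∕✓p691823, ym-ust-20520-w5 g9) and its windows (✓p696943 HARVEST-Cb ∘ ✓p697342, px20 g4) — MODULO exactly one displayed row per
# family: binder (b) of the assembly (★w3-20520 g8's letter d2f54740), the fat-loop Stokes bound `‖axialT (Ũ♯^{(k)}) y₀ (π y_in) − 1‖ ≤ θa + θb` at `θb := d·L·α₁∕8`, ∀-closed over the
# ρ5 member prefix and universally in the [4]∕(1.59) constants.  Its supplier is IN FLIGHT on this bus: ✓p696030 `hStokes_of_rows` (w3-20520 g9) ∘ LEMMA B-al-2 at the member ✓p698270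
# (px15 g4; bricks ✓p693551 ✓p691536 ✓p694380 ✓p694851 ✓p697640 ★w3-19200 g10∕px15, towers ✓p696214∕✓p697296 px3 g5, arithmetic ✓p694819 px10 g4) ∘ (R-P) px3 ∘ (F-h)(F-hU) w3 g11 ∘
# (F-ω) px9 g6 ∘ (B-al-4) w3-20520 g9∕ym-ust-20520-w4 g11 → px15 g4's knit `hStokes_holds` (LEAD-H WORD 22) — when it lands, the v10 packs have NO hypothesis and the registered
# `BirthV10.stub_halvingStep` follows by name (★★OWNER g29 stub-file protocol 04:08:54Z).
# H door of record after this file (on ★★OWNER's flip): ✓`HalvingStubOfHP1RoomRho5.stub_halvingStep_of_hP1roomρ5` ∘ ✓`HalvingP1FlatPillarRoomOfSuppliersRho5.hP1roomρ5_of_suppliers` ∘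
# THIS — BOARD v10-preσ.  σ-EDITION (LEAD-H WORD 24, ★★OWNER RULING g29-№21, px20 g5's LOCATE-THETA-BUDGET): the displayed Stokes row's ∀-tail carries the ONE chart guard of
# record `c' ≤ 2 * ((F.P K).L * cstar) →` (print's (1.42)@(k−1) mechanism, [Balaban1985RegularSpaces] (1.29)∕(1.42)), threaded through composers σ1∕σ2, assembly R34 (σ3) and
# these packs (σ7) — without it the row is not inhabited by the B-al-4 chain (θ-budget floor `1.2·10⁻³·L⁻⁶` vs cap `< 10⁻²⁷`).

Cell `ym3-torus` (HUMAN RULING D-0037, YM ladder rung R3 — YM₃ on T³ is a RUNG, NOT d = 4, NOT the Clay problem; the YM mass gap is NOT proved), width seat `ym-ust-19200-w5`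
gen 7 (successor LEAD-H g7).  `--supports stmt-QuantumFields-19200 --as helper`; count-neutral; def-free, 0 sorry, standard axioms; by-name composition only (generator-written:
hypotheses = the packs' binders VERBATIM, conclusion = `hSupUρ5` VERBATIM); nothing here claims the stub, the crux, the rung or the gap — the displayed Stokes row is a HYPOTHESIS.
References: T. Bałaban, CMP **99** (1985) 75–102 [Balaban1985RegularSpaces] Prop. 3 (1.36)–(1.42) pp.82–83, (1.29) p.81, Thm 4 p.88, p.98; CMP **98** (1985) 17–51
[Balaban1985Averaging] (42)–(43), (84)–(86), (127), Prop. 4; CMP **102** (1985) 277–309 [Balaban1985Variational] (150)–(156) pp.301–302, (163) p.303.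
-/

set_option autoImplicit false

noncomputable section

namespace Summit.QuantumFields.YangMills.Theorems.HalvingHSupURho5OfStokesRowS

open scoped BigOperators Matrix.Norms.L2Operator
open NormedSpace
open Complex (I)
open Literature.MathematicalPhysics.QuantumFieldTheory.Balaban1983to89
open Literature.MathematicalPhysics.QuantumFieldTheory.Balaban1983to89.T3ContinuumYM3Torus
open Literature.MathematicalPhysics.QuantumFieldTheory.Balaban1983to89.T3PrintedRegularMinimiser
open Literature.MathematicalPhysics.QuantumFieldTheory.Balaban1983to89.T3PrintedRegularMinimiser (RegPr regFibrePr mem_regFibrePr_iff)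
open MatrixLog (mlog)
open B5Eq118OneStroke (iterBlockOf)
open B6SectAOperatorsV1 (SiteIdx)
open B7Prop1Explicit renaming Site → LSite
open B7Prop1Explicit (e expUnit l1)
open B7Prop2Explicit (unitaryUnits C0 c2' avgIter)
open B7Eq78Linearization (conjR zdBlocking QprimeIter Rbar_zero)
open B7Eq92Concrete (mgauge mgauge_apply)
open B8Ineq132 (covDerivFwd InAk BondTouches)
open B8Eq131Cubes (cube gs tLo tHi)
open B8Eq131CubesAdmissible (cubeFam cubeFam_false_of_le)
open B8Eq138LandauZd (covDivB covLap QT IsLandau138W logCfg)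
open B8Eq140Level (SideTouches)
open B8Eq182Proof (gAd)
open B8Eq184Proof (gaugeExp cfgExp)
open B8Eq188Proof (frakF3)
open B8LambdaSpaceKLevel (wt)
open B8CubeMemberZd (cubeLamS cubeLamB)
open B10Eq27TorusAxialLog (transl rel pull unitsField toUField suIncl gaugeActT axialT pull_apply unitsField_mem_unitaryUnits)
open B15Eq112TorusCover (lift cover)
open Node00 (coverAt)
open LatticeFieldCalculus (laplace diverg siteAvgIter)
open FlatCubeOpsText (IsLevWeight)
open FlatCubeSequenceAligned (cubeSeqMT3 cubeSetM)
open Summit.QuantumFields.YangMills.Theorems.Prop8ChartDoubleBar (dbarIterU vframeU)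
open HalvingP1FlatPillar (DP1Clause)
open T4Continuum
open B7Prop3Flat (c3)
open B7Prop10General (C6 C4G)
open B7Prop9Flat (C5')
open B7Prop1Local (InBox loK bondHiK)
open B8Ineq130 (tlo thi)
open B8Eq119TwistedAxial (Restr129 InAx bgT)
open B8Eq146AExpansion (iEta)
open B7Prop4GeneralLevels (logCovIter linCovIter)
open B8Eq155JBound (Jcur wsup)
open B8ScaledSupNorm (bondNorm msup)
open B8Eq1117Concrete (XSpace)
open B8Prop5ContractionKLevel (Bd2 Mc Kc)
open B8Eq178Averages (Qnl)
open B8SpecialUnitaryTrace (trCLM trCLM_apply trCLM_mul_comm)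
open Summit.QuantumFields.YangMills.Theorems (FlatMinimizerH.le_T3)
open HalvingHSiteTopKnit (hknit_of_descent)
open P1FlatCoreCubeInclusion (corner_of_offset room_of_level_k)
open HalvingP1FlatCoreSupplierAssembly (hc₁_of_small)
open HalvingHSiteRowsOfSocketsBaseTGammaS (siteRows_of_sockets_baseTγS)
open HalvingH42TopCrossAssemblyR34 (h42topCrossT_of_stokes_allS h42topCrossT_of_stokesS)
open HalvingHStokesWindowOfCb (window_of_cb)
open HalvingHSiteTorusSocketBase (hTorus_base_of_windows)
open HalvingHSupURhoWindowsRho3Cb (exists_topCall_constants_of_rhoWindow₃_cb)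
open HalvingHSiteH42WindowsOfHw (h42Windows_base_of_hw h42Windows_step_of_hw)
open HalvingHSiteHtopOfMember (htopSocket_of_member)
open HalvingHSupURhoWindowsGamma (gammaWindows_of_hw gammaWindows_cstar_of_hw)
open B9SupplySockB9P3ZdBeta (CrossB)
open B9SupplySockB9P3ZdGamma (cubeLamBP')
open B8Lemma1NonAbelian (lowPart)
open HalvingH59GammaDischargeFlatRho5 (H59TLγ5_holds_member)
open HalvingSLetTauFlatCubeMember (SLetτL_holds_member SLetτAllL_holds_member)
open B7Prop2SpecialUnitary (specialUnitaryUnits mem_specialUnitaryUnits specialUnitaryUnits_le_unitaryUnits)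
open HalvingHSiteRowsOfSocketsTGammaS (siteRows_of_socketsTγS)
open HalvingH59GammaDischargeFlatRho5Pair (H59_rho5_pair)
open HalvingHT4TLGammaHoldsMember (hT4TLγ9_of_sLetτAll)
open B7Prop4Flat (C2 c4)
open HalvingHSupURho5OfMemberPacks (hSupUρ5_of_memberPacks)
open HalvingHMemberPackBaseOfStokesRowS (memberPack_base_of_stokesRowS)
open HalvingHMemberPackStepOfStokesRowS (memberPack_step_of_stokesRowS)

open Classical in
/-- ★★★ **(K-final v10-preσ): «H = hSupUρ5» from the base and step STOKES-ROW packs — the only displayed row is binder (b) in the σ-edition (chart guard `c' ≤ 2 * ((F.P K).L * cstar)` in the ∀-tail), the fat-loop Stokes bound; every [4]∕[B8]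
socket of v7γ–v9 is discharged in-pack.**  See the module docstring.
[cite: Balaban1985RegularSpaces, Prop. 3 (1.36)-(1.42) pp.82-83, (1.29) p.81, Thm 4 p.88, p.98; Balaban1985Averaging, (42)-(43), (84)-(86), (127), Prop. 4 pp.38-39; Balaban1985Variational, (150)-(156) pp.301-302, (163) p.303] -/
theorem hSupUρ5_of_stokesRowS
    (hSockets₁ : ∀ L : ℕ, Odd L → 1 < L → ∀ (B₀ B₀'H B₂' BG BR cB9 : ℝ), 0 < B₀ → 0 < B₀'H → 0 ≤ B₂' → 0 ≤ BG → 0 ≤ BR → 0 < cB9 →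
        -- socket (S9): for EVERY choice of the [4]∕(1.59) constants, the (M2′) window constant `Cθ ≥ 0`, the p.98 letters `sx ρ₅`, ONE `∀ M′` binder, and ONLY the collar residual
        ∃ (Cθ : ℝ) (sx ρ₅ : ℕ), 0 ≤ Cθ ∧ ∀ (M' : ℕ), 1 ≤ M' → L ^ (sx + 1) ∣ M' →
        -- binder (b) «σ-edition» (LEAD-H WORD 24): the (M2′) assembly's guarded STOKES ROW `hStokes` (✓`HalvingH42TopCrossAssemblyR34.h42topCrossT_of_stokes_allS`) at `θb := d·L·α₁∕8`, ∀-closed over the ρ5 member prefix; chart guard `c' ≤ 2·(L·cstar)` — the ONE displayed row; supplier-to-be: ✓p696030 `HalvingHStokesRowOfCombDefect.hStokes_of_rows`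
        (∀ (F : T3Family), F.L = L → ∀ (n K : ℕ) (hnK : n < K) (ρ S M ρ' : ℕ), ρ' = ρ + M + L + S → 1 ≤ M → 2 ≤ S → ∀ (a₅ Cr ε₀ ε₁ : ℝ), 0 < Cr → 4 < Cr → 12 * ((ρ : ℝ) + (M : ℝ)) * a₅ ≤ Cr →
          Cθ * ((((ρ + M + L + S : ℕ) : ℝ) + (M' : ℝ) + 1)) ≤ Cr → L ^ (sx + 1) ∣ ρ + M + L + S → ρ₅ ≤ ρ → 0 < ε₁ → 0 < ε₀ → ε₀ ≤ a₅ → Cr * ε₁ ≤ ε₀ →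
          (10 : ℝ) ^ 29 * (L : ℝ) ^ 12 * (1 + B₀ + B₀⁻¹) ^ 2 * ((1 + B₀'H) * (1 + B₂') * (1 + BG) * (1 + BR)) ^ 5 * (1 + cB9⁻¹) * ((((ρ + M + L + S : ℕ) : ℝ) + (M' : ℝ) + 1) ^ 3 * ε₀) ≤ 1 →
          2 * ρ + (M' + 1 + 2 * (M + L + S)) ≤ F.L ^ (F.m + n) → ∀ (V : GaugeField (F.P n) 0 (Matrix.specialUnitaryGroup (Fin 2) ℂ)), PlaqSmall ε₁ V → ∀ U ∈ regFibrePr F n K hnK.le ε₀ V,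
          ∀ (x₀ : Site (F.P K) 0) (t : ℤ), 0 ≤ t → t ≤ (M' : ℤ) - 1 → ∀ (a : LSite (F.P K).d), a = (fun μ => ((iterBlockOf (K - n) x₀ μ).val : ℤ) - t) →
          ∀ (α₁ α₄ cstar : ℝ), α₁ = 198 * (((ρ' : ℝ) + M' + 1) * ε₀) + 27 * (((ρ' : ℝ) + M' + 1) * ε₀) / ((L : ℝ) * B₀) → cstar = 5 * (F.P K).d * (F.P K).L * B₀ * (ε₀ + α₁) →
          α₄ = 8 * (300 * (L : ℝ) * ((3 * (M' + ρ') + 1 : ℕ) : ℝ) * (B₀'H + 15 * (L : ℝ) ^ 2 * BG * BR + 3 * BG * BR * B₂')) * (5 * ((3 : ℕ) : ℝ) * L * B₀) * (ε₀ + α₁) → ∀ (s : ℝ), s = (198 + 12 * (((M' : ℝ) - 1) + 4 * ρ')) * ε₀ →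
          ∀ (gJ : GaugeTransf (F.P K) 0 (Matrix.specialUnitaryGroup (Fin 2) ℂ)) (u₁ : LSite (F.P K).d → (Matrix (Fin 2) (Fin 2) ℂ)ˣ)
          (W : LSite (F.P K).d → Fin (F.P K).d → (Matrix (Fin 2) (Fin 2) ℂ)ˣ) (A : LSite (F.P K).d → Fin (F.P K).d → Matrix (Fin 2) (Fin 2) ℂ) (c₁ c' : ℝ)
          (κf : (Site (F.P K) 0 → Matrix (Fin 2) (Fin 2) ℂ) → (i : ℕ) → GaugeTransf (F.P K) i (Matrix (Fin 2) (Fin 2) ℂ)ˣ) (lam : LSite (F.P K).d → Matrix (Fin 2) (Fin 2) ℂ),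
          InAk (F.P K).L (K - n) (((F.L : ℝ)⁻¹) ^ (K - n)) ε₀ (fun _ => (Set.univ : Set (LSite (F.P K).d))) (pull (unitsField (toUField (GaugeField.gaugeAct gJ U))) 0) →
          (∀ m', m' ≤ K - n → ∀ Λ : ℕ → Set (LSite (F.P K).d), InAx (F.P K).L m' Λ (1 : LSite (F.P K).d → Fin (F.P K).d → (Matrix (Fin 2) (Fin 2) ℂ)ˣ) (pull (unitsField (toUField (GaugeField.gaugeAct gJ U))) 0)) →
          (∀ m', m' ≤ K - n → ∀ (x : LSite (F.P K).d) (ν : Fin (F.P K).d), tlo (F.P K).L (tLo a ρ') m' ≤ x → x + e ν ≤ thi (F.P K).L (tHi a M' ρ') m' →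
          ‖((avgIter (F.P K).L (pull (unitsField (toUField (GaugeField.gaugeAct gJ U))) 0) (K - n - m') x ν : (Matrix (Fin 2) (Fin 2) ℂ)ˣ) : Matrix (Fin 2) (Fin 2) ℂ) - 1‖ < s) →
          (∀ (x : LSite (F.P K).d) (ν : Fin (F.P K).d), tLo a ρ' ≤ x → x + e ν ≤ tHi a M' ρ' → lowPart ν (x - tLo a ρ') = 0 →
          avgIter (F.P K).L (pull (unitsField (toUField (GaugeField.gaugeAct gJ U))) 0) (K - n) x ν = 1) →
          (∀ z, ((u₁ z : (Matrix (Fin 2) (Fin 2) ℂ)ˣ) : Matrix (Fin 2) (Fin 2) ℂ) ∈ Matrix.specialUnitaryGroup (Fin 2) ℂ) →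
          mgauge (1 : LSite (F.P K).d → Fin (F.P K).d → (Matrix (Fin 2) (Fin 2) ℂ)ˣ) u₁ W = pull (unitsField (toUField (GaugeField.gaugeAct gJ U))) 0 →
          0 ≤ c' → 8 * 3800 * ((((F.P K).d + 2) * (F.P K).L : ℕ) : ℝ) ^ 2 * c' ≤ 1 → c' ≤ 2 * ((F.P K).L * cstar) →
          Real.exp c₁ - 1 ≤ ((F.L : ℝ)⁻¹) ^ (K - n) * c' →
          (∀ z ∈ cube (F.P K).L a M' ρ' (K - n) (K - n), ∀ ν : Fin (F.P K).d, W z ν = cfgExp (((F.L : ℝ)⁻¹) ^ (K - n)) A z ν ∧ ((F.L : ℝ)⁻¹) ^ (K - n) * ‖A z ν‖ ≤ c₁) →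
          (∀ (m : Site (F.P K) 0 → Matrix (Fin 2) (Fin 2) ℂ) (i : ℕ) (y : Site (F.P K) (i + 1)), κf m (i + 1) y = (vframeU (gaugeActT (κf m i) (dbarIterU i (gaugeActT
          (fun s => (u₁ (lift (F.P K) x₀ + rel x₀ s))⁻¹ * Unitary.toUnits (suIncl (gJ s)) : GaugeTransf (F.P K) 0 (Matrix (Fin 2) (Fin 2) ℂ)ˣ)
          (unitsField (toUField U))))) y)⁻¹ * κf m i (emb y) * vframeU (dbarIterU i (gaugeActT
          (fun s => (u₁ (lift (F.P K) x₀ + rel x₀ s))⁻¹ * Unitary.toUnits (suIncl (gJ s)) : GaugeTransf (F.P K) 0 (Matrix (Fin 2) (Fin 2) ℂ)ˣ) (unitsField (toUField U)))) y) →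
          (∀ (m : Site (F.P K) 0 → Matrix (Fin 2) (Fin 2) ℂ) (x : Site (F.P K) 0), ((κf m 0 x : (Matrix (Fin 2) (Fin 2) ℂ)ˣ) : Matrix (Fin 2) (Fin 2) ℂ) = exp (m x)) →
          (∀ x, IsSelfAdjoint (lam x)) → (∀ x, (lam x).trace = 0) → (∀ yc ∈ cubeLamS (F.P K).L a M' ρ' (K - n) (K - n) (K - n),
          κf (((-I) • lam) ∘ fun s : Site (F.P K) 0 => lift (F.P K) x₀ + rel x₀ s) (K - n) (coverAt (F.P K) (K - n) yc) = axialT (dbarIterU (K - n) (gaugeActT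
          (fun s => (u₁ (lift (F.P K) x₀ + rel x₀ s))⁻¹ * Unitary.toUnits (suIncl (gJ s)) : GaugeTransf (F.P K) 0 (Matrix (Fin 2) (Fin 2) ℂ)ˣ)
          (unitsField (toUField U)))) (iterBlockOf (K - n) x₀) (coverAt (F.P K) (K - n) yc)) →
          (∀ j, j ≤ K - n → ∀ b ∈ {b : LSite (F.P K).d × Fin (F.P K).d | SideTouches ((cubeFam false (F.P K).L a M' ρ' (K - n)) j) b.1 b.2},
          ‖lam b.1‖ ≤ α₄ ∧ wt (F.P K).L (((F.L : ℝ)⁻¹) ^ (K - n)) j * ‖covDerivFwd (((F.L : ℝ)⁻¹) ^ (K - n)) (1 : LSite (F.P K).d → Fin (F.P K).d → (Matrix (Fin 2) (Fin 2) ℂ)ˣ) b.2 lam b.1‖ ≤ α₄) →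
          Restr129 (F.P K).L (K - n) (cubeLamS (F.P K).L a M' ρ' (K - n) (K - n)) (1 : LSite (F.P K).d → Fin (F.P K).d → (Matrix (Fin 2) (Fin 2) ℂ)ˣ) u₁ →
          Restr129 (F.P K).L (K - n) (Function.update (cubeLamS (F.P K).L a M' ρ' (K - n) (K - n)) (K - n) ∅) (1 : LSite (F.P K).d → Fin (F.P K).d → (Matrix (Fin 2) (Fin 2) ℂ)ˣ) (u₁ * gaugeExp lam) →
          ∀ yc ∈ cubeLamS (F.P K).L a M' ρ' (K - n) (K - n) (K - n),
          ‖((axialT (dbarIterU (K - n) (gaugeActT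
          (fun s => (u₁ (lift (F.P K) x₀ + rel x₀ s))⁻¹ * Unitary.toUnits (suIncl (gJ s)) : GaugeTransf (F.P K) 0 (Matrix (Fin 2) (Fin 2) ℂ)ˣ)
          (unitsField (toUField U)))) (iterBlockOf (K - n) x₀) (coverAt (F.P K) (K - n) yc) : (Matrix (Fin 2) (Fin 2) ℂ)ˣ) : Matrix (Fin 2) (Fin 2) ℂ) - 1‖ ≤ (((F.P K).d : ℝ) * (F.P K).L * α₁ / 8)))
    (hSockets₂ : ∀ L : ℕ, Odd L → 1 < L → ∀ (B₀ B₀'H B₂' BG BR cB9 : ℝ), 0 < B₀ → 0 < B₀'H → 0 ≤ B₂' → 0 ≤ BG → 0 ≤ BR → 0 < cB9 →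
        -- socket (S9): for EVERY choice of the [4]∕(1.59) constants, the (M2′) window constant `Cθ ≥ 0`, the p.98 letters `sx ρ₅`, ONE `∀ M′` binder, and ONLY the collar residual
        ∃ (Cθ : ℝ) (sx ρ₅ : ℕ), 0 ≤ Cθ ∧ ∀ (M' : ℕ), 1 ≤ M' → L ^ (sx + 1) ∣ M' →
        -- binder (b) «σ-edition» (LEAD-H WORD 24): the (M2′) assembly's guarded STOKES ROW `hStokes` (✓`HalvingH42TopCrossAssemblyR34.h42topCrossT_of_stokesS`) at `θb := d·L·α₁∕8`, ∀-closed over the ρ5 member prefix (chart guard `c' ≤ 2·(L·cstar)`) — the ONE displayed row; its supplier is ✓p696030 `HalvingHStokesRowOfCombDefect.hStokes_of_rows` once ITS four rows are theorems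
        (∀ (F : T3Family), F.L = L → ∀ (n K : ℕ) (hnK : n < K) (ρ S M ρ' : ℕ), ρ' = ρ + M + L + S → 1 ≤ M → 2 ≤ S → ∀ (a₅ Cr ε₀ ε₁ : ℝ), 0 < Cr → 4 < Cr → 12 * ((ρ : ℝ) + (M : ℝ)) * a₅ ≤ Cr →
          Cθ * ((((ρ + M + L + S : ℕ) : ℝ) + (M' : ℝ) + 1)) ≤ Cr → L ^ (sx + 1) ∣ ρ + M + L + S → ρ₅ ≤ ρ → 0 < ε₁ → 0 < ε₀ → ε₀ ≤ a₅ → Cr * ε₁ ≤ ε₀ →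
          (10 : ℝ) ^ 29 * (L : ℝ) ^ 12 * (1 + B₀ + B₀⁻¹) ^ 2 * ((1 + B₀'H) * (1 + B₂') * (1 + BG) * (1 + BR)) ^ 5 * (1 + cB9⁻¹) * ((((ρ + M + L + S : ℕ) : ℝ) + (M' : ℝ) + 1) ^ 3 * ε₀) ≤ 1 →
          2 * ρ + (M' + 1 + 2 * (M + L + S)) ≤ F.L ^ (F.m + n) → ∀ (V : GaugeField (F.P n) 0 (Matrix.specialUnitaryGroup (Fin 2) ℂ)), PlaqSmall ε₁ V → ∀ U ∈ regFibrePr F n K hnK.le ε₀ V,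
          ∀ (x₀ : Site (F.P K) 0) (t : ℤ), 0 ≤ t → t ≤ (M' : ℤ) - 1 → ∀ (a : LSite (F.P K).d), a = (fun μ => ((iterBlockOf (K - n) x₀ μ).val : ℤ) - t) →
          ∀ (α₁ α₄ cstar : ℝ), α₁ = 198 * (((ρ' : ℝ) + M' + 1) * ε₀) + 27 * (((ρ' : ℝ) + M' + 1) * ε₀) / ((L : ℝ) * B₀) → cstar = 5 * (F.P K).d * (F.P K).L * B₀ * (ε₀ + α₁) →
          α₄ = 8 * (300 * (L : ℝ) * ((3 * (M' + ρ') + 1 : ℕ) : ℝ) * (B₀'H + 15 * (L : ℝ) ^ 2 * BG * BR + 3 * BG * BR * B₂')) * (5 * ((3 : ℕ) : ℝ) * L * B₀) * (ε₀ + α₁) →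
          ∀ (s : ℝ), s = (198 + 12 * (((M' : ℝ) - 1) + 4 * ρ')) * ε₀ →
          ∀ (gJ : GaugeTransf (F.P K) 0 (Matrix.specialUnitaryGroup (Fin 2) ℂ)) (u₁ : LSite (F.P K).d → (Matrix (Fin 2) (Fin 2) ℂ)ˣ)
          (W : LSite (F.P K).d → Fin (F.P K).d → (Matrix (Fin 2) (Fin 2) ℂ)ˣ) (A : LSite (F.P K).d → Fin (F.P K).d → Matrix (Fin 2) (Fin 2) ℂ) (c₁ c' : ℝ)
          (κf : (Site (F.P K) 0 → Matrix (Fin 2) (Fin 2) ℂ) → (i : ℕ) → GaugeTransf (F.P K) i (Matrix (Fin 2) (Fin 2) ℂ)ˣ) (lam : LSite (F.P K).d → Matrix (Fin 2) (Fin 2) ℂ),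
          InAk (F.P K).L (K - n) (((F.L : ℝ)⁻¹) ^ (K - n)) ε₀ (fun _ => (Set.univ : Set (LSite (F.P K).d))) (pull (unitsField (toUField (GaugeField.gaugeAct gJ U))) 0) →
          (∀ m', m' ≤ K - n → ∀ Λ : ℕ → Set (LSite (F.P K).d), InAx (F.P K).L m' Λ (1 : LSite (F.P K).d → Fin (F.P K).d → (Matrix (Fin 2) (Fin 2) ℂ)ˣ) (pull (unitsField (toUField (GaugeField.gaugeAct gJ U))) 0)) →
          (∀ m', m' ≤ K - n → ∀ (x : LSite (F.P K).d) (ν : Fin (F.P K).d), tlo (F.P K).L (tLo a ρ') m' ≤ x → x + e ν ≤ thi (F.P K).L (tHi a M' ρ') m' →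
          ‖((avgIter (F.P K).L (pull (unitsField (toUField (GaugeField.gaugeAct gJ U))) 0) (K - n - m') x ν : (Matrix (Fin 2) (Fin 2) ℂ)ˣ) : Matrix (Fin 2) (Fin 2) ℂ) - 1‖ < s) →
          (∀ (x : LSite (F.P K).d) (ν : Fin (F.P K).d), tLo a ρ' ≤ x → x + e ν ≤ tHi a M' ρ' → lowPart ν (x - tLo a ρ') = 0 →
          avgIter (F.P K).L (pull (unitsField (toUField (GaugeField.gaugeAct gJ U))) 0) (K - n) x ν = 1) →
          (∀ z, ((u₁ z : (Matrix (Fin 2) (Fin 2) ℂ)ˣ) : Matrix (Fin 2) (Fin 2) ℂ) ∈ Matrix.specialUnitaryGroup (Fin 2) ℂ) →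
          mgauge (1 : LSite (F.P K).d → Fin (F.P K).d → (Matrix (Fin 2) (Fin 2) ℂ)ˣ) u₁ W = pull (unitsField (toUField (GaugeField.gaugeAct gJ U))) 0 →
          0 ≤ c' → 8 * 3800 * ((((F.P K).d + 2) * (F.P K).L : ℕ) : ℝ) ^ 2 * c' ≤ 1 → c' ≤ 2 * ((F.P K).L * cstar) →
          Real.exp c₁ - 1 ≤ ((F.L : ℝ)⁻¹) ^ (K - n) * c' →
          (∀ z ∈ cube (F.P K).L a M' ρ' (K - n) (K - n), ∀ ν : Fin (F.P K).d, W z ν = cfgExp (((F.L : ℝ)⁻¹) ^ (K - n)) A z ν ∧ ((F.L : ℝ)⁻¹) ^ (K - n) * ‖A z ν‖ ≤ c₁) →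
          (∀ (m : Site (F.P K) 0 → Matrix (Fin 2) (Fin 2) ℂ) (i : ℕ) (y : Site (F.P K) (i + 1)), κf m (i + 1) y = (vframeU (gaugeActT (κf m i) (dbarIterU i (gaugeActT
          (fun s => (u₁ (lift (F.P K) x₀ + rel x₀ s))⁻¹ * Unitary.toUnits (suIncl (gJ s)) : GaugeTransf (F.P K) 0 (Matrix (Fin 2) (Fin 2) ℂ)ˣ)
          (unitsField (toUField U))))) y)⁻¹ * κf m i (emb y) * vframeU (dbarIterU i (gaugeActT
          (fun s => (u₁ (lift (F.P K) x₀ + rel x₀ s))⁻¹ * Unitary.toUnits (suIncl (gJ s)) : GaugeTransf (F.P K) 0 (Matrix (Fin 2) (Fin 2) ℂ)ˣ) (unitsField (toUField U)))) y) →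
          (∀ (m : Site (F.P K) 0 → Matrix (Fin 2) (Fin 2) ℂ) (x : Site (F.P K) 0), ((κf m 0 x : (Matrix (Fin 2) (Fin 2) ℂ)ˣ) : Matrix (Fin 2) (Fin 2) ℂ) = exp (m x)) →
          (∀ x, IsSelfAdjoint (lam x)) → (∀ x, (lam x).trace = 0) → (∀ yc ∈ cubeLamS (F.P K).L a M' ρ' (K - n) (K - n) (K - n),
          κf (((-I) • lam) ∘ fun s : Site (F.P K) 0 => lift (F.P K) x₀ + rel x₀ s) (K - n) (coverAt (F.P K) (K - n) yc) = axialT (dbarIterU (K - n) (gaugeActT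
          (fun s => (u₁ (lift (F.P K) x₀ + rel x₀ s))⁻¹ * Unitary.toUnits (suIncl (gJ s)) : GaugeTransf (F.P K) 0 (Matrix (Fin 2) (Fin 2) ℂ)ˣ)
          (unitsField (toUField U)))) (iterBlockOf (K - n) x₀) (coverAt (F.P K) (K - n) yc)) →
          (∀ j, j ≤ K - n → ∀ b ∈ {b : LSite (F.P K).d × Fin (F.P K).d | SideTouches ((cubeFam false (F.P K).L a M' ρ' (K - n)) j) b.1 b.2},
          ‖lam b.1‖ ≤ α₄ ∧ wt (F.P K).L (((F.L : ℝ)⁻¹) ^ (K - n)) j * ‖covDerivFwd (((F.L : ℝ)⁻¹) ^ (K - n)) (1 : LSite (F.P K).d → Fin (F.P K).d → (Matrix (Fin 2) (Fin 2) ℂ)ˣ) b.2 lam b.1‖ ≤ α₄) →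
          Restr129 (F.P K).L (K - n) (cubeLamS (F.P K).L a M' ρ' (K - n) (K - n)) (1 : LSite (F.P K).d → Fin (F.P K).d → (Matrix (Fin 2) (Fin 2) ℂ)ˣ) u₁ →
          Restr129 (F.P K).L (K - n) (Function.update (cubeLamS (F.P K).L a M' ρ' (K - n) (K - n)) (K - n) ∅) (1 : LSite (F.P K).d → Fin (F.P K).d → (Matrix (Fin 2) (Fin 2) ℂ)ˣ) (u₁ * gaugeExp lam) →
          ∀ yc ∈ cubeLamS (F.P K).L a M' ρ' (K - n) (K - n) (K - n),
          ‖((axialT (dbarIterU (K - n) (gaugeActT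
          (fun s => (u₁ (lift (F.P K) x₀ + rel x₀ s))⁻¹ * Unitary.toUnits (suIncl (gJ s)) : GaugeTransf (F.P K) 0 (Matrix (Fin 2) (Fin 2) ℂ)ˣ)
          (unitsField (toUField U)))) (iterBlockOf (K - n) x₀) (coverAt (F.P K) (K - n) yc) : (Matrix (Fin 2) (Fin 2) ℂ)ˣ) : Matrix (Fin 2) (Fin 2) ℂ) - 1‖ ≤ (((F.P K).d : ℝ) * (F.P K).L * α₁ / 8))) :
    ∀ L : ℕ, Odd L → 1 < L → ∃ (Mₚ Rₚ sx ρ₅ : ℕ) (Cθ : ℝ), ∀ (R M aₑ S : ℕ) (hM : 1 ≤ M), M = L ^ aₑ → Mₚ ≤ M → Rₚ ≤ R → R * M ≤ S →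
      ∃ B₁ : ℝ, 0 ≤ B₁ ∧ ∃ M' : ℕ, 1 ≤ M' ∧ ∃ Cρ : ℝ, 0 < Cρ ∧ ∃ qρ : ℕ,
      ∀ (ρ : ℕ) (a Cr : ℝ), 0 < Cr → 4 < Cr → 12 * ((ρ : ℝ) + (M : ℝ)) * a ≤ Cr → Cθ * ((ρ + M + L + S : ℕ) : ℝ) ≤ Cr → L ^ (sx + 1) ∣ ρ + M + L + S → ρ₅ ≤ ρ →
        16 * 3800 * ((5 * L : ℕ) : ℝ) ^ 2 * (L : ℝ) * ((B₁ * ((ρ : ℝ) + 1) ^ qρ + 1) * a) ≤ 1 → Cρ * ((ρ : ℝ) + 1) ^ qρ * a ≤ 1 →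
        ∀ F : T3Family, F.L = L → ∀ (n K : ℕ) (hnK : n < K), 2 * ρ + (M' + 1 + 2 * (M + L + S)) ≤ F.L ^ (F.m + n) →
          ∀ (ε₀ ε₁ : ℝ), 0 < ε₁ → 0 < ε₀ → ε₀ ≤ a → Cr * ε₁ ≤ ε₀ →
          ∀ V : GaugeField (F.P n) 0 (Matrix.specialUnitaryGroup (Fin 2) ℂ), PlaqSmall ε₁ V →
            ∀ U ∈ regFibrePr F n K hnK.le ε₀ V, ∀ x₀ : Site (F.P K) 0,
              ∃ (t : ℤ) (_ : 0 ≤ t) (_ : t ≤ (M' : ℤ) - 1)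
                (w : LSite (F.P K).d → Matrix.specialUnitaryGroup (Fin 2) ℂ) (X : LSite (F.P K).d → Fin (F.P K).d → Matrix (Fin 2) (Fin 2) ℂ)
                (μ : ℕ → LSite (F.P K).d → Matrix (Fin 2) (Fin 2) ℂ)
                (g h' : GaugeTransf (F.P K) 0 (Matrix (Fin 2) (Fin 2) ℂ)ˣ) (κ' : (i : ℕ) → GaugeTransf (F.P K) i (Matrix (Fin 2) (Fin 2) ℂ)ˣ)
                (ν : (i : ℕ) → Site (F.P K) i → (Matrix (Fin 2) (Fin 2) ℂ)ˣ) (gs' : (i : ℕ) → GaugeTransf (F.P K) i (Matrix (Fin 2) (Fin 2) ℂ)ˣ),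
                -- [N05 ∕ J3] chart rows and flat Landau window at the corner `a := Bᵏx₀ − t`
                (∀ z ∈ cube (F.P K).L (fun μ => ((iterBlockOf (K - n) x₀ μ).val : ℤ) - t) M' (ρ + M + L + S) (K - n) 0, ∀ ν : Fin (F.P K).d,
                  transl (0 : Site (F.P K) 0) z ∈ cubeSetM x₀ (K - n) ρ S M 0 → (transl (0 : Site (F.P K) 0) z).shift ν ∈ cubeSetM x₀ (K - n) ρ S M 0 →
                  ‖(((Unitary.toUnits (suIncl (w z)))⁻¹ * unitsField (toUField U) ⟨transl 0 z, ν⟩ * Unitary.toUnits (suIncl (w (z + e ν))) :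
                      (Matrix (Fin 2) (Fin 2) ℂ)ˣ) : Matrix (Fin 2) (Fin 2) ℂ) - 1‖ ≤ 1 / 4) ∧
                (∀ z ∈ cube (F.P K).L (fun μ => ((iterBlockOf (K - n) x₀ μ).val : ℤ) - t) M' (ρ + M + L + S) (K - n) 0, ∀ ν : Fin (F.P K).d,
                  transl (0 : Site (F.P K) 0) z ∈ cubeSetM x₀ (K - n) ρ S M 0 → (transl (0 : Site (F.P K) 0) z).shift ν ∈ cubeSetM x₀ (K - n) ρ S M 0 →
                  I • ((((F.L : ℝ)⁻¹) ^ (K - n)) • X z ν) = mlog (((Unitary.toUnits (suIncl (w z)))⁻¹ * unitsField (toUField U) ⟨transl 0 z, ν⟩ *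
                      Unitary.toUnits (suIncl (w (z + e ν))) : (Matrix (Fin 2) (Fin 2) ℂ)ˣ) : Matrix (Fin 2) (Fin 2) ℂ)) ∧
                (∀ z ∈ cube (F.P K).L (fun μ => ((iterBlockOf (K - n) x₀ μ).val : ℤ) - t) M' (ρ + M + L + S) (K - n) 0,
                  covLap (((F.L : ℝ)⁻¹) ^ (K - n)) (1 : LSite (F.P K).d → Fin (F.P K).d → (Matrix (Fin 2) (Fin 2) ℂ)ˣ)
                      ((cube (F.P K).L (fun μ => ((iterBlockOf (K - n) x₀ μ).val : ℤ) - t) M' (ρ + M + L + S) (K - n) 0).indicator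
                        (covDivB (((F.L : ℝ)⁻¹) ^ (K - n)) (1 : LSite (F.P K).d → Fin (F.P K).d → (Matrix (Fin 2) (Fin 2) ℂ)ˣ) X)) z =
                    QT (F.P K).L (K - n) (cubeLamS (F.P K).L (fun μ => ((iterBlockOf (K - n) x₀ μ).val : ℤ) - t) M' (ρ + M + L + S) (K - n) (K - n))
                      (1 : LSite (F.P K).d → Fin (F.P K).d → (Matrix (Fin 2) (Fin 2) ℂ)ˣ) μ z) ∧
                -- [top step] frames, composite gauge, top identity
                κ' 0 = h' ∧
                (∀ (i : ℕ) (y : Site (F.P K) (i + 1)),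
                  κ' (i + 1) y = (vframeU (gaugeActT (κ' i) (dbarIterU i (gaugeActT g (unitsField (toUField U))))) y)⁻¹ * κ' i (emb y) *
                    vframeU (dbarIterU i (gaugeActT g (unitsField (toUField U)))) y) ∧
                (∀ s, ν 0 s = 1) ∧
                (∀ (i : ℕ) (y : Site (F.P K) (i + 1)), ν (i + 1) y = ν i (emb y) * vframeU (dbarIterU i (gaugeActT g (unitsField (toUField U)))) y) ∧
                gs' 0 = g ∧ (∀ (i : ℕ) (y : Site (F.P K) (i + 1)), gs' (i + 1) y = gs' i (emb y)) ∧
                (∀ s, (Unitary.toUnits (suIncl (w (lift (F.P K) x₀ + rel x₀ s))))⁻¹ =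
                  ((gs' (K - n) (iterBlockOf (K - n) x₀))⁻¹ * ν (K - n) (iterBlockOf (K - n) x₀)) * h' s * g s) ∧
                (∀ yc ∈ cubeLamS (F.P K).L (fun μ => ((iterBlockOf (K - n) x₀ μ).val : ℤ) - t) M' (ρ + M + L + S) (K - n) (K - n) (K - n),
                  κ' (K - n) (coverAt (F.P K) (K - n) yc) =
                    axialT (dbarIterU (K - n) (gaugeActT g (unitsField (toUField U)))) (iterBlockOf (K - n) x₀) (coverAt (F.P K) (K - n) yc)) ∧
                -- [sizes] the two (1.36)♭ rows of `A := X ∘ rep`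
                (∀ wt : ℕ → PBond (F.P K) 0 → ℝ, IsLevWeight F n K (cubeSeqMT3 F n K x₀ ρ S M hM) wt →
                  (∀ b : PBond (F.P K) 0, wt 1 b *
                    ‖(fun b : PBond (F.P K) 0 => if b.src ∈ cubeSetM x₀ (K - n) ρ S M 0 ∧ b.tgt ∈ cubeSetM x₀ (K - n) ρ S M 0 then
                      X (lift (F.P K) x₀ + rel x₀ b.src) b.dir else 0) b‖ ≤ B₁ * ((ρ : ℝ) + 1) ^ qρ * ε₀) ∧
                  (∀ (b : PBond (F.P K) 0) (ν' : Fin (F.P K).d), wt 2 b * (F.L : ℝ) ^ (K - n) *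
                    ‖(fun b : PBond (F.P K) 0 => if b.src ∈ cubeSetM x₀ (K - n) ρ S M 0 ∧ b.tgt ∈ cubeSetM x₀ (K - n) ρ S M 0 then
                        X (lift (F.P K) x₀ + rel x₀ b.src) b.dir else 0) ⟨b.src.shift ν', b.dir⟩ -
                      (fun b : PBond (F.P K) 0 => if b.src ∈ cubeSetM x₀ (K - n) ρ S M 0 ∧ b.tgt ∈ cubeSetM x₀ (K - n) ρ S M 0 then
                        X (lift (F.P K) x₀ + rel x₀ b.src) b.dir else 0) b‖ ≤ B₁ * ((ρ : ℝ) + 1) ^ qρ * ε₀)) :=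
  hSupUρ5_of_memberPacks (memberPack_base_of_stokesRowS hSockets₁) (memberPack_step_of_stokesRowS hSockets₂)

end Summit.QuantumFields.YangMills.Theorems.HalvingHSupURho5OfStokesRowS

end
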